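import Summits.AtomisticToContinuum.FouriersLaw.Theorems.VanishingNoiseTransferVanishingNoiseBoundUniformLocalMinorization
import Literature.MathematicalPhysics.KineticTheory.LangevinChainReach
import Literature.Probability.Process.SmallSets

/-!
# CEHR Prop. 3.6 on energy shells with constants UNIFORM in the bath temperatures
(helper for stub S2a `stub_uniformAsymmetryTransfer`, line `fekete-usc-one-length`)

`--supports stmt-AtomisticToContinuum-11976` helper file (crux `VanishingNoiseBound`, route
`VanishingNoiseTransfer`). In the tree the minorisation of the transition kernels of the pinned
chain on a compact set (`pinnedChain_minorization`, CEHR Prop. 3.6) is obtained at FIXED bath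
temperatures by a compactness argument (`SmallSets.lean`: Feller lower semicontinuity + pointed
irreducibility). For Harris' theorem with temperature-uniform constants one needs the
minorisation time and weight uniform for temperatures in a compact range; this file proves it on
the sublevel sets `{H ≤ E}` (which is where Harris' theorem uses it):

* `pinnedChain_exists_forall_hamiltonian_freeFlow_lt` — LaSalle UNIFORMLY on `{H ≤ E}`: the
  undriven chain has energy `< h` at all times `t ≥ s₁`, one `s₁` for the whole shell;
* `pinnedChain_transitionKernel_ball_ge_uniform` — `P_t(z, B(0,r)) ≥ p(t) > 0` for all
  `z ∈ {H ≤ E}`, all `t ≥ s₁` and all temperatures with amplitudes `≤ c_max` (the zero-control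
  support argument of `LangevinChainReach.lean` made uniform);
* `pinnedChain_minorization_uniform` — an integer time `m` and a weight `α > 0` with
  `P_m(z,·) ≥ α ν` (`ν` a probability measure) for all `z ∈ {H ≤ E}` and ALL temperatures with
  amplitudes in `[c_min, c_max]` (Chapman–Kolmogorov with the uniform local small set of
  `…UniformLocalMinorization.lean`).

No definitions.
-/

noncomputable section

open MeasureTheory ProbabilityTheory Filter Topology Set Metric Function
open scoped NNReal ENNReal

namespace Summit.AtomisticToContinuum.FouriersLaw.Theorems.FixedLengthNoiseContinuity

open Literature.MathematicalPhysics.KineticTheory.HeatConduction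
open Literature.Probability.Process OscillatorChain

variable {N : ℕ}

/-! ### Uniform LaSalle on compact energy shells -/

section Reach

variable {ω₂ lam β γ : ℝ} (hω : 0 < ω₂) (hl : 0 ≤ lam) (hβ : 0 ≤ β) (hγ : 0 < γ) (hN : 0 < N)
include hω hl hβ hγ hN

/-- **LaSalle, uniformly on a sublevel set of the energy**: for `E` and `h > 0` there is `s₁ ≥ 0`
such that the undriven damped chain started anywhere in `{H ≤ E}` has energy `< h` at ALL times
`t ≥ s₁` (pointwise LaSalle `pinnedChain_tendsto_freeFlow_zero`, continuity of `y ↦ H(φ_t y)`,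
compactness of `{H ≤ E}`, and monotonicity of the energy along the undriven flow). -/
theorem pinnedChain_exists_forall_hamiltonian_freeFlow_lt (E : ℝ) {h : ℝ} (hh : 0 < h) :
    ∃ s₁ : ℝ, 0 ≤ s₁ ∧ ∀ z : PhaseSpace N, (pinnedChain ω₂ lam β γ).hamiltonian N z ≤ E →
      ∀ t : ℝ, s₁ ≤ t →
        (pinnedChain ω₂ lam β γ).hamiltonian N ((pinnedChain ω₂ lam β γ).chainFlow N z 0 t) < h := by
  set P := pinnedChain ω₂ lam β γ with hP
  have hHc := pinnedChain_continuous_hamiltonian ω₂ lam β γ N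
  have hH0 : P.hamiltonian N 0 = 0 := by
    simp [hP, OscillatorChain.hamiltonian, pinnedChain]
  -- pointwise: a time at which the energy is below `h`
  have hex : ∀ z : PhaseSpace N, ∃ t : ℝ, 0 ≤ t ∧ P.hamiltonian N (P.chainFlow N z 0 t) < h := by
    intro z
    have hlim := (hHc.tendsto 0).comp (pinnedChain_tendsto_freeFlow_zero hω hl hβ hγ hN z)
    rw [hH0] at hlim
    obtain ⟨t, ht⟩ := (((tendsto_order.1 hlim).2 h hh).and (eventually_ge_atTop 0)).exists
    exact ⟨t, ht.2, ht.1⟩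
  choose tz htz0 htz using hex
  -- the open cover of the compact sublevel set
  set K : Set (PhaseSpace N) := {z | P.hamiltonian N z ≤ E} with hK
  have hKc : IsCompact K := pinnedChain_isCompact_setOf_hamiltonian_le hω hl hβ γ N E
  set U : PhaseSpace N → Set (PhaseSpace N) := fun z => {y | P.hamiltonian N (P.chainFlow N y 0 (tz z)) < h}
  have hU : ∀ z ∈ K, U z ∈ 𝓝 z := fun z _ =>
    (isOpen_lt (hHc.comp (pinnedChain_continuous_chainFlow_left hω hl hβ hγ.le N (η := 0)
      continuous_zero (tz z))) continuous_const).mem_nhds (htz z)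
  obtain ⟨J, -, hJcov⟩ := hKc.elim_nhds_subcover U hU
  refine ⟨∑ z ∈ J, tz z, Finset.sum_nonneg fun z _ => htz0 z, fun y hy t ht => ?_⟩
  obtain ⟨z, hzJ, hyz⟩ := Set.mem_iUnion₂.1 (hJcov hy)
  have htzle : tz z ≤ t :=
    (Finset.single_le_sum (f := tz) (fun w _ => htz0 w) hzJ).trans ht
  exact (pinnedChain_antitone_hamiltonian_freeFlow hω hl hβ hγ.le N y htzle).trans_lt hyz

/-- **Every sublevel set of the energy reaches every ball at the equilibrium with probability
bounded below, uniformly in the bath temperatures**: for `E`, `r > 0` and an amplitude bound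
`c_max` there is `s₁` such that for every time `t ≥ s₁` some `p > 0` satisfies
`P_t(z, B(0, r)) ≥ p` for ALL `z ∈ {H ≤ E}` and ALL bath temperatures with `√(2γT_b) ≤ c_max`.
Proof of `pinnedChain_transitionKernel_pos_of_mem_nhds_zero` (`LangevinChainReach.lean`) made
uniform: uniform LaSalle (`pinnedChain_exists_forall_hamiltonian_freeFlow_lt`, `{H < h} ⊆ B(0,r/2)`),
continuity in the noise on `{H ≤ E}` (`pinnedChain_exists_norm_chainFlow_sub_lt`), and the small
ball of the Brownian pair scaled by `c_max` (`wienerPair_forall_abs_brownian_le_pos`). -/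
theorem pinnedChain_transitionKernel_ball_ge_uniform (E : ℝ) {r : ℝ} (hr : 0 < r) {cmax : ℝ}
    (hcmax : 0 ≤ cmax) :
    ∃ s₁ : ℝ, 0 ≤ s₁ ∧ ∀ t : ℝ≥0, s₁ ≤ (t : ℝ) → ∃ p : ℝ≥0∞, 0 < p ∧
      ∀ T_L T_R : ℝ, Real.sqrt (2 * γ * T_L) ≤ cmax → Real.sqrt (2 * γ * T_R) ≤ cmax →
        ∀ z : PhaseSpace N, (pinnedChain ω₂ lam β γ).hamiltonian N z ≤ E →
          p ≤ (pinnedChain ω₂ lam β γ).transitionKernel N T_L T_R t z (ball 0 r) := by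
  -- adapted from `pinnedChain_transitionKernel_pos_of_mem_nhds_zero` (Literature/…/LangevinChainReach.lean)
  set P := pinnedChain ω₂ lam β γ with hP
  -- a small energy forces a small norm: `{H ≤ h} ⊆ B̄(0, r/4)`
  set h : ℝ := min ω₂ 1 * r ^ 2 / 32 with hh
  have hh0 : 0 < h := by positivity
  have hsmall : ∀ y : PhaseSpace N, P.hamiltonian N y ≤ h → ‖y‖ ≤ r / 4 := by
    intro y hy
    have h1 := pinnedChain_setOf_hamiltonian_le_subset_closedBall hω hl hβ γ N h hy
    rw [mem_closedBall, dist_zero_right] at h1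
    refine h1.trans (max_le ?_ ?_)
    · rw [Real.sqrt_le_left (by positivity), div_le_iff₀ hω, hh]
      nlinarith [min_le_left ω₂ 1, sq_nonneg r, hω]
    · rw [Real.sqrt_le_left (by positivity), hh]
      nlinarith [min_le_right ω₂ 1, sq_nonneg r, (lt_min hω one_pos).le]
  -- uniform LaSalle
  obtain ⟨s₁, hs₁, hlas⟩ := pinnedChain_exists_forall_hamiltonian_freeFlow_lt hω hl hβ hγ hN E hh0
  refine ⟨s₁, hs₁, fun t ht => ?_⟩
  -- continuity in the noise on `[0, t]`, noise bounded by `1`, uniformly on `{H ≤ E}`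
  obtain ⟨δ, hδ, hcont⟩ := pinnedChain_exists_norm_chainFlow_sub_lt hω hl hβ hγ.le N E 1 (t : ℝ)
    (half_pos hr)
  -- the small ball of the Brownian pair, scaled by `c_max`
  set ε' : ℝ := min δ 1 / (cmax + cmax + 1) with hε'
  have hC : 0 < cmax + cmax + 1 := by positivity
  have hε'0 : 0 < ε' := div_pos (lt_min hδ one_pos) hC
  have hε'b : (cmax + cmax) * ε' ≤ min δ 1 := by
    rw [hε', mul_div_assoc', div_le_iff₀ hC]
    have : 0 ≤ min δ 1 := (lt_min hδ one_pos).le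
    nlinarith
  set A : Set WienerPair := {ω | ∀ u : ℝ≥0, u ≤ t → |brownian u ω.1| ≤ ε' ∧ |brownian u ω.2| ≤ ε'}
    with hA
  refine ⟨wienerPair A, wienerPair_forall_abs_brownian_le_pos t hε'0, fun T_L T_R hTL hTR z hz => ?_⟩
  set cL : ℝ := Real.sqrt (2 * γ * T_L) with hcL
  set cR : ℝ := Real.sqrt (2 * γ * T_R) with hcR
  have hcLa : |cL| ≤ cmax := by rw [abs_of_nonneg (Real.sqrt_nonneg _)]; exact hTL
  have hcRa : |cR| ≤ cmax := by rw [abs_of_nonneg (Real.sqrt_nonneg _)]; exact hTR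
  have hfree : ‖P.chainFlow N z 0 t‖ < r / 2 := by
    have := hsmall _ (hlas z hz t ht).le
    linarith
  -- on `A`, the solution lands in `B(0, r)`
  have hsub : A ⊆ (fun ω => P.solMap N T_L T_R t z (pairPath ω)) ⁻¹' ball 0 r := by
    intro ω hωA
    rw [mem_preimage, mem_ball, dist_zero_right]
    set η : ℝ → Fin N → ℝ := chainNoise N cL cR (pairPath ω) with hη
    have hηc : Continuous η := continuous_chainNoise cL cR (pairPath ω)
    have hηsmall : ∀ s ∈ Icc (0 : ℝ) t, ‖η s‖ ≤ min δ 1 := by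
      intro s hs
      have hst : s.toNNReal ≤ t := Real.toNNReal_le_iff_le_coe.2 hs.2
      obtain ⟨h1, h2⟩ := hωA _ hst
      refine (norm_chainNoise_pairPath_le cL cR ω s).trans (le_trans ?_ hε'b)
      have hcL0 : 0 ≤ |cL| := abs_nonneg _
      have hcR0 : 0 ≤ |cR| := abs_nonneg _
      nlinarith [mul_le_mul_of_nonneg_left h1 hcL0, mul_le_mul_of_nonneg_left h2 hcR0,
        mul_le_mul_of_nonneg_right hcLa hε'0.le, mul_le_mul_of_nonneg_right hcRa hε'0.le]
    have h1 : ‖P.chainFlow N z η t - P.chainFlow N z 0 t‖ < r / 2 :=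
      hcont z hz η 0 hηc continuous_zero
        (fun s hs => (hηsmall s hs).trans (min_le_right _ _))
        (fun s _ => by simp)
        (fun s hs => by simpa using (hηsmall s hs).trans (min_le_left _ _))
        t ⟨t.coe_nonneg, le_rfl⟩
    have hsol : P.solMap N T_L T_R t z (pairPath ω) = P.chainFlow N z η t := rfl
    rw [hsol]
    calc ‖P.chainFlow N z η t‖ = ‖(P.chainFlow N z η t - P.chainFlow N z 0 t) + P.chainFlow N z 0 t‖ := by
          rw [sub_add_cancel]
      _ ≤ ‖P.chainFlow N z η t - P.chainFlow N z 0 t‖ + ‖P.chainFlow N z 0 t‖ := norm_add_le _ _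
      _ < r / 2 + r / 2 := add_lt_add h1 hfree
      _ = r := by ring
  calc wienerPair A ≤ wienerPair ((fun ω => P.solMap N T_L T_R t z (pairPath ω)) ⁻¹' ball 0 r) :=
        measure_mono hsub
    _ = P.transitionKernel N T_L T_R t z (ball 0 r) :=
        (pinnedChain_transitionKernel_apply' hω hl hβ hγ.le N T_L T_R t z measurableSet_ball).symm

end Reach

/-! ### The uniform minorisation on sublevel sets of the energy -/

section Minor

variable {ω₂ lam β γ : ℝ} (hω : 0 < ω₂) (hl : 0 ≤ lam) (hβ : 0 < β) (hγ : 0 < γ) (hN : 0 < N)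
include hω hl hβ hγ hN

/-- **CEHR Prop. 3.6 on sublevel sets of the energy, UNIFORM in the bath temperatures.** For
`E` and `0 < c_min ≤ c_max` there are an integer time `m ≥ 1` and a weight `α > 0` such that for
ALL bath temperatures with amplitudes `√(2γT_b) ∈ [c_min, c_max]` some probability measure `ν`
satisfies `P_m(z, ·) ≥ α ν` for every `z ∈ {H ≤ E}`. Chapman–Kolmogorov: reach the ball
`B(0, ε₁)` at the integer time `m - 1 ≥ s₁` (`pinnedChain_transitionKernel_ball_ge_uniform`), then
the uniform local small set at time `1` (`pinnedChain_minorization_at_one_uniform`), with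
`ν = Leb(· ∩ B(0,r))/Leb(B(0,r))`. -/
theorem pinnedChain_minorization_uniform (E : ℝ) {cmin cmax : ℝ} (hc0 : 0 < cmin) (hcle : cmin ≤ cmax) :
    ∃ (m : ℕ) (α : ℝ), 0 < m ∧ 0 < α ∧
      ∀ T_L T_R : ℝ, cmin ≤ Real.sqrt (2 * γ * T_L) → Real.sqrt (2 * γ * T_L) ≤ cmax →
        cmin ≤ Real.sqrt (2 * γ * T_R) → Real.sqrt (2 * γ * T_R) ≤ cmax →
        ∃ ν : Measure (PhaseSpace N), IsProbabilityMeasure ν ∧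
          ∀ z : PhaseSpace N, (pinnedChain ω₂ lam β γ).hamiltonian N z ≤ E →
            ENNReal.ofReal α • ν ≤ (pinnedChain ω₂ lam β γ).transitionKernel N T_L T_R (m : ℝ≥0) z := by
  set P := pinnedChain ω₂ lam β γ with hP
  haveI hpiP : (volume : Measure (Fin N → ℝ)).IsAddHaarMeasure := isAddHaarMeasure_volume_pi _
  haveI hvolP : (volume : Measure (PhaseSpace N)).IsAddHaarMeasure :=
    Measure.prod.instIsAddHaarMeasure (volume : Measure (Fin N → ℝ)) (volume : Measure (Fin N → ℝ))
  -- the uniform local small set at time `1`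
  obtain ⟨ε₁, hε₁, r, hr, c, hc, hloc⟩ := pinnedChain_minorization_at_one_uniform hω hl hβ hγ hN hc0 hcle
  -- the uniform reachability of `B(0, ε₁)` at the integer time `⌈s₁⌉`
  obtain ⟨s₁, hs₁, hreach⟩ := pinnedChain_transitionKernel_ball_ge_uniform hω hl hβ.le hγ hN E hε₁
    (hc0.le.trans hcle)
  set n₁ : ℕ := ⌈s₁⌉₊ with hn₁
  obtain ⟨p, hp, hpz⟩ := hreach (n₁ : ℝ≥0) (by push_cast; exact Nat.le_ceil s₁)
  -- the reference probability measure `ν = Leb(· ∩ B(0,r))/Leb(B(0,r))`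
  have hB0 : volume (ball (0 : PhaseSpace N) r) ≠ 0 := (measure_ball_pos volume 0 hr).ne'
  have hBtop : volume (ball (0 : PhaseSpace N) r) ≠ ⊤ := measure_ball_lt_top.ne
  set ν : Measure (PhaseSpace N) := (volume (ball (0 : PhaseSpace N) r))⁻¹ • volume.restrict (ball 0 r) with hν
  haveI hνP : IsProbabilityMeasure ν := ⟨by
    rw [hν, Measure.smul_apply, Measure.restrict_apply MeasurableSet.univ, univ_inter, smul_eq_mul,
      ENNReal.inv_mul_cancel hB0 hBtop]⟩
  -- the weight `α`: the real number of `min (p c Leb(B(0,r))) 1`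
  set w : ℝ≥0∞ := min (p * c * volume (ball (0 : PhaseSpace N) r)) 1 with hw
  have hw0 : w ≠ 0 := by
    rw [hw]; exact (lt_min (ENNReal.mul_pos (ENNReal.mul_pos hp.ne' hc.ne').ne' hB0) one_pos).ne'
  have hwtop : w ≠ ⊤ := ne_top_of_le_ne_top ENNReal.one_ne_top (min_le_right _ _)
  refine ⟨n₁ + 1, w.toReal, Nat.succ_pos _, ENNReal.toReal_pos hw0 hwtop,
    fun T_L T_R hL1 hL2 hR1 hR2 => ⟨ν, hνP, fun z hz => ?_⟩⟩
  rw [ENNReal.ofReal_toReal hwtop]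
  have hpz' := hpz T_L T_R hL2 hR2 z hz
  have hadd := pinnedChain_transitionKernel_add hω hl hβ.le hγ.le N T_L T_R
  refine Measure.le_iff.2 fun s hs => ?_
  -- Chapman–Kolmogorov: `P_{n₁+1}(z, s) ≥ P_{n₁}(z, B(0,ε₁)) · inf_{w ∈ B(0,ε₁)} P_1(w, s)`
  have hinf : ∀ y ∈ ball (0 : PhaseSpace N) ε₁,
      c * volume (s ∩ ball 0 r) ≤ P.transitionKernel N T_L T_R 1 y s := fun y hy =>
    (hloc T_L T_R hL1 hL2 hR1 hR2 y (mem_ball_zero_iff.1 hy) (s ∩ ball 0 r) inter_subset_right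
      (hs.inter measurableSet_ball)).trans (measure_mono inter_subset_left)
  have hCK := MarkovSemigroup.mul_apply_le_comp_apply (P.transitionKernel N T_L T_R) hadd (n₁ : ℝ≥0) 1 z
    hs hinf
  have hcast : ((n₁ + 1 : ℕ) : ℝ≥0) = (n₁ : ℝ≥0) + 1 := by push_cast; ring
  rw [hcast]
  refine le_trans ?_ (hCK.trans' (mul_le_mul' le_rfl hpz'))
  rw [Measure.smul_apply, hν, Measure.smul_apply, Measure.restrict_apply hs, smul_eq_mul, smul_eq_mul]
  calc w * ((volume (ball (0 : PhaseSpace N) r))⁻¹ * volume (s ∩ ball 0 r))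
      ≤ (p * c * volume (ball (0 : PhaseSpace N) r)) *
          ((volume (ball (0 : PhaseSpace N) r))⁻¹ * volume (s ∩ ball 0 r)) :=
        mul_le_mul' (min_le_left _ _) le_rfl
    _ = c * volume (s ∩ ball 0 r) * p *
          (volume (ball (0 : PhaseSpace N) r) * (volume (ball (0 : PhaseSpace N) r))⁻¹) := by ring
    _ = c * volume (s ∩ ball 0 r) * p := by rw [ENNReal.mul_inv_cancel hB0 hBtop, mul_one]

end Minor

/-- Registered helper sub-goal `helper_uniformMinorization` of stmt-AtomisticToContinuum-11976
(= `pinnedChain_minorization_uniform`, fully quantified, notation-free one-line form). -/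
theorem helper_uniformMinorization : ∀ (ω₂ lam β γ : ℝ), 0 < ω₂ → 0 ≤ lam → 0 < β → 0 < γ → ∀ (N : ℕ), 0 < N → ∀ (E cmin cmax : ℝ), 0 < cmin → cmin ≤ cmax → ∃ (m : ℕ) (α : ℝ), 0 < m ∧ 0 < α ∧ ∀ T_L T_R : ℝ, cmin ≤ Real.sqrt (2 * γ * T_L) → Real.sqrt (2 * γ * T_L) ≤ cmax → cmin ≤ Real.sqrt (2 * γ * T_R) → Real.sqrt (2 * γ * T_R) ≤ cmax → ∃ ν : MeasureTheory.Measure (Literature.MathematicalPhysics.KineticTheory.HeatConduction.PhaseSpace N), MeasureTheory.IsProbabilityMeasure ν ∧ ∀ z : Literature.MathematicalPhysics.KineticTheory.HeatConduction.PhaseSpace N, (Literature.MathematicalPhysics.KineticTheory.HeatConduction.pinnedChain ω₂ lam β γ).hamiltonian N z ≤ E → ENNReal.ofReal α • ν ≤ (Literature.MathematicalPhysics.KineticTheory.HeatConduction.pinnedChain ω₂ lam β γ).transitionKernel N T_L T_R (m : NNReal) z :=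
  fun _ _ _ _ hω hl hβ hγ _ hN E _ _ hc0 hcle => pinnedChain_minorization_uniform hω hl hβ hγ hN E hc0 hcle

end Summit.AtomisticToContinuum.FouriersLaw.Theorems.FixedLengthNoiseContinuity

end
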